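import Summits.RiemannHypothesis.RiemannHypothesis.Theorems.SignConeConeMagnificationCaraDamped
import Summits.RiemannHypothesis.RiemannHypothesis.Theorems.SignConeConeMagnificationPoissonDigamma
import HarnessLib

/-!
# Carathéodory ⟹ unit slack (the converse of `stub_cara`)

Sub-problem `RiemannHypothesis`, route `SignCone`, crux `ConeMagnification` (stmt-RiemannHypothesis-16303),
seat 0, session 9.  Main file of the series `…CaraLine` (damped tests, right edge for general coefficients,
pole part on both sides, critical-line weight), `…CaraGrowth` (Borel–Carathéodory growth), `…CaraShift`
(contour shift), `…CaraDamped` (the damped fake explicit formula at fixed `δ`).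

**Theorem (`unitSlack_of_cara`).**  Let `c : ℕ → ℝ` with `Σ |c(n)| n^{-σ} < ∞` for `σ > 1`, and suppose some
`F` holomorphic on `Re s > 1/2` equals `L_c(s) − 1/(s−1)` on `Re s > 1` and satisfies the Carathéodory
majorant `Re F(s) ≤ 1/2 + Re(1/s) + 𝒜(s) − ½ log π`, `𝒜(s) = (1/2π)∫ Re ψ(1/4+iv/2)·(σ−½)/((σ−½)²+(t−v)²) dv`
(`= ½ Re ψ(s/2)`, `poissonArch_eq_half_re_digamma`).  Then `c` has UNIT SLACK against every Weil test `g`: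
`−‖g‖₂² ≤ Re (M(0) + M(1) + W_ar(G) − Σₙ c(n) n^{-1/2} (G(log n) + G(−log n)))`, `G = g ⋆ g̃`.
No sign condition and no normalisation `c(1) = 0` is needed.  Together with the landed forward direction
(`stub_cara`, fed by `stub_fakePNT`, `stub_chebyshev`, `stub_continuation`, `stub_pdLaplace`) this identifies the
unit-slack cone of the crux with the Carathéodory class: for `c ≥ 0`, `c(1) = 0`,
unit slack ⟺ (`Σ c(n) n^{-σ} < ∞` for `σ > 1`) ∧ (Carathéodory data) — so the open core `stub_designOfOffline`
(THM X) is a statement about nonnegative Dirichlet series alone: "`c ≥ 0`, `L_c − 1/(s−1)` holomorphic on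
`Re s > 1/2` with real part below `1/2 + Re(1/s) + ½Re ψ(s/2) − ½log π` ⟹ RH".

**Proof.**  Fix `g`, put `G = g ⋆ g̃`, `S = G + G(−·)` and damp: `K_δ(u) = e^{−δu} S(u)` (`0 < δ ≤ 1/4`), a test
function with `K̂_δ(s) = Ŝ(s − δ)`.  On `Re s = 2` the right edge of the explicit formula holds for ANY
absolutely convergent coefficients: `2π Σ c(n) n^{-1/2} K_δ(log n) = ∫ L_c K̂_δ dy`
(`integral_LSeries_mul_weilMellin_vertical`).  Write `L_c = F + 1/(s−1)`; the pole part is read on both lines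
`Re s = 2` and `Re s = 1/2 + δ` in closed form, the two readings differing by `2π K̂_δ(1) = 2π Ŝ(1−δ)`
(`integral_weilMellin_vertical_div_sub_sub`); `F K̂_δ` is shifted to `Re s = 1/2 + δ` by Cauchy's theorem, the
growth `‖F(σ+it)‖ ≤ C_δ(1+|t|)` coming from the ONE-SIDED majorant by Borel–Carathéodory (`norm_le_linear_of_cara`,
`integral_mul_weilMellin_vertical_shift`).  On that line `K̂_δ(1/2+δ+iy) = Ŝ(1/2+iy) = |ĝ(½+iy)|² + |ĝ(½−iy)|² ≥ 0`
(`weilMellin_weilSymm_autocorr_half`), so taking real parts the majorant enters (`re_fake_explicit_damped_le`):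
`2π Re Σ c(n) n^{-1/2-δ} S(log n) ≤ ∫ (A(s) + Re 1/(s−1)) Ŝ dy + 2π Re Ŝ(1−δ)`, `s = 1/2+δ+iy`.  Let `δ → 0+`
(finite node sum; dominated convergence with the bound `(C + log(1+|y|)) Ŝ`; continuity of `Ŝ`): at `δ = 0`
the two polar kernels `Re(1/s) + Re(1/(s−1))` CANCEL on the critical line (`caraKernel_half`), `Ŝ(1) = M(0)+M(1)`,
`∫ Ŝ(1/2+iy) dy = 4π G(0) = 4π‖g‖₂²` and `∫ Re ψ(1/4+iy/2) Ŝ(1/2+iy) dy = 2·(archimedean integral of G)`, which is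
exactly `2π (‖g‖₂² + Re W_ar(G) + Re (M(0)+M(1)))` on the right.

References: E. Bombieri, Rend. Lincei (9) 11 (2000) §2 (explicit formula by contour shift); E. C. Titchmarsh,
The Theory of Functions (1939) §5.5 (Borel–Carathéodory); this route's `StubCara` (forward direction) and
`PoissonDigamma` (the bridge `𝒜 = ½Re ψ(s/2)`).
-/

noncomputable section

-- `Summit.RiemannHypothesis.RiemannHypothesis.…` repeats a namespace component by design (D-0017 layout).
set_option linter.dupNamespace false

open Complex Filter Set MeasureTheory Metric LSeries Literature.NumberTheory.LFunctions
open scoped Real Topology ComplexConjugate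

namespace Summit.RiemannHypothesis.RiemannHypothesis.Theorems.SignConeConeMagnification

variable {g : ℝ → ℂ}

/-! ### The limit `δ → 0+` -/

/-- `{s | 0 < Re s < 1}` is open. [folklore] -/
theorem isOpen_strip_zero_one : IsOpen {s : ℂ | 0 < s.re ∧ s.re < 1} :=
  (isOpen_lt continuous_const continuous_re).inter (isOpen_lt continuous_re continuous_const)

/-- On the critical line the two polar kernels cancel and the majorant kernel is
`1/2 − ½log π + ½Re ψ(1/4 + iy/2)`. [folklore] -/
theorem caraKernel_half (y : ℝ) :
    1 / 2 + (1 / ((((1 / 2 + 0 : ℝ) : ℂ) + y * I))).re +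
        (digamma ((((1 / 2 + 0 : ℝ) : ℂ) + y * I) / 2)).re / 2 - Real.log π / 2 +
        (1 / ((((1 / 2 + 0 : ℝ) : ℂ) + y * I) - 1)).re =
      1 / 2 - Real.log π / 2 + (digamma (1 / 4 + y / 2 * I)).re / 2 := by
  have e1 : (((1 / 2 + 0 : ℝ) : ℂ) + y * I) / 2 = 1 / 4 + y / 2 * I := by push_cast; ring
  have e2 : (1 / ((((1 / 2 + 0 : ℝ) : ℂ) + y * I))).re + (1 / ((((1 / 2 + 0 : ℝ) : ℂ) + y * I) - 1)).re = 0 := by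
    have h1 : (1 / ((((1 / 2 + 0 : ℝ) : ℂ) + y * I))).re = (1 / 2) / (1 / 4 + y ^ 2) := by
      simp only [one_div, inv_re, normSq_apply, add_re, ofReal_re, mul_re, I_re, mul_zero, ofReal_im,
        I_im, mul_one, sub_self, add_zero, add_im, mul_im, zero_add]
      ring_nf
    have h2 : (1 / ((((1 / 2 + 0 : ℝ) : ℂ) + y * I) - 1)).re = -(1 / 2) / (1 / 4 + y ^ 2) := by
      simp only [one_div, inv_re, normSq_apply, sub_re, add_re, ofReal_re, mul_re, I_re, mul_zero,
        ofReal_im, I_im, mul_one, sub_self, add_zero, one_re, sub_im, add_im, mul_im, zero_add, one_im,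
        sub_zero]
      ring_nf
    rw [h1, h2]
    ring
  rw [e1]
  linarith [e2]

/-- **Dominated convergence for the majorant integral**: as `δ → 0+`,
`∫ (A(1/2+δ+iy) + Re(1/(δ−1/2+iy))) P(y) dy → ∫ (1/2 − ½log π + ½Re ψ(1/4+iy/2)) P(y) dy`. [folklore] -/
theorem tendsto_integral_caraKernel {S : ℝ → ℂ} (hS : IsWeilTest S) {P : ℝ → ℝ}
    (hP : ∀ y : ℝ, weilMellin S (1 / 2 + y * I) = P y) :
    Tendsto (fun δ : ℝ => ∫ y : ℝ, (1 / 2 + (1 / ((((1 / 2 + δ : ℝ) : ℂ) + y * I))).re +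
        (digamma ((((1 / 2 + δ : ℝ) : ℂ) + y * I) / 2)).re / 2 - Real.log π / 2 +
        (1 / ((((1 / 2 + δ : ℝ) : ℂ) + y * I) - 1)).re) * P y) (𝓝[>] 0)
      (𝓝 (∫ y : ℝ, (1 / 2 - Real.log π / 2 + (digamma (1 / 4 + y / 2 * I)).re / 2) * P y)) := by
  obtain ⟨B, hBi, hB⟩ := exists_integrable_bound_caraKernel hS hP
  set k : ℂ → ℝ := fun s => 1 / 2 + (1 / s).re + (digamma (s / 2)).re / 2 - Real.log π / 2 +
    (1 / (s - 1)).re with hk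
  have hkc : ContinuousOn k {s : ℂ | 0 < s.re ∧ s.re < 1} := continuousOn_caraKernel
  have hPc : Continuous P := by
    have e : P = fun y : ℝ => (weilMellin S (1 / 2 + (y : ℂ) * I)).re :=
      funext fun y => by rw [hP, ofReal_re]
    rw [e]
    exact continuous_re.comp ((continuous_weilMellin hS.1.continuous hS.2).comp (by fun_prop))
  have hmem : ∀ δ : ℝ, 0 ≤ δ → δ < 1 / 2 → ∀ y : ℝ,
      (((1 / 2 + δ : ℝ) : ℂ) + y * I) ∈ {s : ℂ | 0 < s.re ∧ s.re < 1} := fun δ h0 h1 y => by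
    simp only [mem_setOf_eq, add_re, ofReal_re, mul_re, I_re, mul_zero, ofReal_im, I_im, mul_one,
      sub_self, add_zero]
    constructor <;> linarith
  have hI4 : ∀ᶠ δ in 𝓝[>] (0 : ℝ), δ ∈ Ioo (0 : ℝ) (1 / 4) := Ioo_mem_nhdsGT (by norm_num)
  have h := tendsto_integral_filter_of_dominated_convergence B ?_ ?_ hBi ?_
      (F := fun (δ : ℝ) (y : ℝ) => k (((1 / 2 + δ : ℝ) : ℂ) + y * I) * P y) (l := 𝓝[>] (0 : ℝ))
      (f := fun y : ℝ => (1 / 2 - Real.log π / 2 + (digamma (1 / 4 + y / 2 * I)).re / 2) * P y)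
      (μ := volume)
  · simpa only [hk] using h
  · refine hI4.mono fun δ hδ => ?_
    refine (Continuous.mul ?_ hPc).aestronglyMeasurable
    exact hkc.comp_continuous (by fun_prop) (hmem δ hδ.1.le (by linarith [hδ.2]))
  · refine hI4.mono fun δ hδ => Eventually.of_forall fun y => ?_
    simpa only [hk] using hB δ hδ.1.le hδ.2.le y
  · refine Eventually.of_forall fun y => ?_
    have hlim : Tendsto (fun δ : ℝ => k (((1 / 2 + δ : ℝ) : ℂ) + y * I)) (𝓝 0)
        (𝓝 (k (((1 / 2 + 0 : ℝ) : ℂ) + y * I))) := by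
      have hca : ContinuousAt k (((1 / 2 + (0 : ℝ) : ℝ) : ℂ) + y * I) :=
        hkc.continuousAt (isOpen_strip_zero_one.mem_nhds (hmem 0 le_rfl (by norm_num) y))
      have hin : Continuous fun δ : ℝ => (((1 / 2 + δ : ℝ) : ℂ) + y * I) := by fun_prop
      exact hca.tendsto.comp (hin.tendsto 0)
    have h2 := (hlim.mono_left (nhdsWithin_le_nhds (s := Ioi (0 : ℝ)))).mul_const (P y)
    simp only [hk] at h2 ⊢
    rw [caraKernel_half y] at h2
    exact h2

/-- **The damped node sum is continuous at `δ = 0`**: for a compactly supported `S` the sum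
`Σₙ c(n) n^{-1/2} e^{-δ log n} S(log n)` is finite, hence tends to `Σₙ c(n) n^{-1/2} S(log n)`. [folklore] -/
theorem tendsto_tsum_damped (c : ℕ → ℝ) {S : ℝ → ℂ} (hS : IsWeilTest S) :
    Tendsto (fun δ : ℝ => ∑' n : ℕ, ((c n : ℝ) : ℂ) / (Real.sqrt n : ℂ) *
        (cexp (-((δ : ℂ) * (Real.log n : ℝ))) * S (Real.log n))) (𝓝[>] 0)
      (𝓝 (∑' n : ℕ, ((c n : ℝ) : ℂ) / (Real.sqrt n : ℂ) * S (Real.log n))) := by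
  -- the support of `S` is bounded: `S(log n) = 0` for `n ≥ N`
  obtain ⟨R, hR⟩ := hS.2.isCompact.isBounded.subset_closedBall 0
  set N : ℕ := ⌈Real.exp R⌉₊ + 1 with hN
  have hvan : ∀ n : ℕ, N ≤ n → S (Real.log n) = 0 := by
    intro n hn
    apply image_eq_zero_of_notMem_tsupport
    intro hmem
    have h1 := hR hmem
    rw [mem_closedBall, dist_zero_right, Real.norm_eq_abs] at h1
    have hn1 : (1 : ℝ) ≤ n := by
      have : 1 ≤ N := by simp [hN]
      exact_mod_cast this.trans hn
    have hlog : R < Real.log n := by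
      rw [Real.lt_log_iff_exp_lt (by linarith)]
      have h2 : Real.exp R ≤ ⌈Real.exp R⌉₊ := Nat.le_ceil _
      have h3 : ((⌈Real.exp R⌉₊ : ℕ) : ℝ) + 1 ≤ n := by
        have : N ≤ n := hn
        simp only [hN] at this
        exact_mod_cast this
      linarith
    have : Real.log n ≤ R := (le_abs_self _).trans h1
    linarith
  have hfin : ∀ δ : ℝ, (∑' n : ℕ, ((c n : ℝ) : ℂ) / (Real.sqrt n : ℂ) *
      (cexp (-((δ : ℂ) * (Real.log n : ℝ))) * S (Real.log n))) =
      ∑ n ∈ Finset.range N, ((c n : ℝ) : ℂ) / (Real.sqrt n : ℂ) *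
        (cexp (-((δ : ℂ) * (Real.log n : ℝ))) * S (Real.log n)) := fun δ =>
    tsum_eq_sum fun n hn => by
      rw [hvan n (by simpa using hn)]
      simp
  have hfin0 : (∑' n : ℕ, ((c n : ℝ) : ℂ) / (Real.sqrt n : ℂ) * S (Real.log n)) =
      ∑ n ∈ Finset.range N, ((c n : ℝ) : ℂ) / (Real.sqrt n : ℂ) * S (Real.log n) :=
    tsum_eq_sum fun n hn => by
      rw [hvan n (by simpa using hn)]
      simp
  have hcont : Continuous fun δ : ℝ => ∑ n ∈ Finset.range N, ((c n : ℝ) : ℂ) / (Real.sqrt n : ℂ) *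
      (cexp (-((δ : ℂ) * (Real.log n : ℝ))) * S (Real.log n)) :=
    continuous_finsetSum _ fun n _ => by fun_prop
  have h0 := hcont.tendsto 0
  simp only [ofReal_zero, zero_mul, neg_zero, Complex.exp_zero, one_mul] at h0
  simp_rw [hfin, hfin0]
  exact h0.mono_left nhdsWithin_le_nhds

/-! ### Assembly: Carathéodory ⟹ unit slack -/

/-- **Carathéodory ⟹ unit slack** (digamma form of the majorant): if `Σ|c(n)|n^{-σ} < ∞` for `σ > 1`
and some `F` holomorphic on `Re s > 1/2` equals `L_c − 1/(s−1)` on `Re s > 1` and satisfies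
`Re F(s) ≤ 1/2 + Re(1/s) + ½Re ψ(s/2) − ½log π` there, then `c` has unit slack against every Weil test:
`−‖g‖₂² ≤ Re (W_ar(g ⋆ g̃) − Σₙ c(n) n^{-1/2} ((g⋆g̃)(log n) + (g⋆g̃)(−log n)))`. [folklore] -/
theorem unitSlack_of_cara_digamma {c : ℕ → ℝ} {F : ℂ → ℂ}
    (hsum : ∀ σ : ℝ, 1 < σ → LSeriesSummable (fun n => ((c n : ℝ) : ℂ)) σ)
    (hFd : DifferentiableOn ℂ F {s : ℂ | 1 / 2 < s.re})
    (hFL : ∀ s : ℂ, 1 < s.re → F s = LSeries (fun n => ((c n : ℝ) : ℂ)) s - 1 / (s - 1))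
    (hFA : ∀ s : ℂ, 1 / 2 < s.re →
      (F s).re ≤ 1 / 2 + (1 / s).re + (digamma (s / 2)).re / 2 - Real.log π / 2)
    {g : ℝ → ℂ} (hg : IsWeilTest g) :
    -(∫ t, ‖g t‖ ^ 2) ≤
      (weilPolarTerm (weilConv g (weilReflect g)) + weilArchTerm (weilConv g (weilReflect g)) -
        ∑' n : ℕ, ((c n : ℝ) : ℂ) / (Real.sqrt n : ℂ) *
          (weilConv g (weilReflect g) (Real.log n) + weilConv g (weilReflect g) (-Real.log n))).re := by
  set G := weilConv g (weilReflect g) with hGdef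
  have hG : IsWeilTest G := hg.weilConv hg.weilReflect
  have hS : IsWeilTest (weilSymm G) := hG.weilSymm
  set P : ℝ → ℝ := fun y => ‖weilMellin g (1 / 2 + y * I)‖ ^ 2 +
    ‖weilMellin g (1 / 2 + ((-y : ℝ) : ℂ) * I)‖ ^ 2 with hPdef
  have hP : ∀ y : ℝ, weilMellin (weilSymm G) (1 / 2 + y * I) = P y := fun y => by
    simp only [hPdef, hGdef]
    exact weilMellin_weilSymm_autocorr_half hg y
  have hP0 : ∀ y : ℝ, 0 ≤ P y := fun y => by positivity
  -- the inequality at fixed `δ ∈ (0, 1/4)` and the three limits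
  have hle : ∀ᶠ δ : ℝ in 𝓝[>] (0 : ℝ),
      2 * π * (∑' n : ℕ, ((c n : ℝ) : ℂ) / (Real.sqrt n : ℂ) *
        (cexp (-(((δ : ℝ) : ℂ) * (Real.log n : ℝ))) * weilSymm G (Real.log n))).re ≤
      (∫ y : ℝ, (1 / 2 + (1 / ((((1 / 2 + δ : ℝ) : ℂ) + y * I))).re +
          (digamma ((((1 / 2 + δ : ℝ) : ℂ) + y * I) / 2)).re / 2 - Real.log π / 2 +
          (1 / ((((1 / 2 + δ : ℝ) : ℂ) + y * I) - 1)).re) * P y) +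
      2 * π * (weilMellin (weilSymm G) (1 - (δ : ℂ))).re :=
    Filter.eventually_of_mem (Ioo_mem_nhdsGT (by norm_num : (0 : ℝ) < 1 / 4)) fun δ hδ =>
      re_fake_explicit_damped_le hsum hFd hFL hFA hS hP hP0 hδ.1 hδ.2.le
  have hT : Tendsto (fun δ : ℝ => 2 * π * (∑' n : ℕ, ((c n : ℝ) : ℂ) / (Real.sqrt n : ℂ) *
      (cexp (-((δ : ℂ) * (Real.log n : ℝ))) * weilSymm G (Real.log n))).re) (𝓝[>] 0)
      (𝓝 (2 * π * (∑' n : ℕ, ((c n : ℝ) : ℂ) / (Real.sqrt n : ℂ) * weilSymm G (Real.log n)).re)) :=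
    ((continuous_re.tendsto _).comp (tendsto_tsum_damped c hS)).const_mul _
  have hW : Tendsto (fun δ : ℝ => 2 * π * (weilMellin (weilSymm G) (1 - δ)).re) (𝓝[>] 0)
      (𝓝 (2 * π * (weilMellin (weilSymm G) 1).re)) := by
    have hc : Continuous fun δ : ℝ => 2 * π * (weilMellin (weilSymm G) (1 - δ)).re :=
      continuous_const.mul (continuous_re.comp ((continuous_weilMellin hS.1.continuous hS.2).comp
        (by fun_prop)))
    have := hc.tendsto 0
    simp only [ofReal_zero, sub_zero] at this
    exact this.mono_left nhdsWithin_le_nhds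
  have hlim := le_of_tendsto_of_tendsto hT ((tendsto_integral_caraKernel hS hP).add hW) hle
  -- evaluate the limit
  have hiP : Integrable fun y : ℝ => (P y : ℂ) := by
    have h := integrable_weilMellin_vertical hS (1 / 2)
    have e : ((1 / 2 : ℝ) : ℂ) = 1 / 2 := by push_cast; ring
    simp only [e, hP] at h
    exact h
  have hiPr : Integrable P := by simpa using hiP.re
  have hiD : Integrable fun y : ℝ => ((digamma (1 / 4 + y / 2 * I)).re : ℂ) * (P y : ℂ) := by
    have h := integrable_reDigamma_mul_weilMellin_half hS
    simp only [hP] at h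
    exact h
  have hiDr : Integrable fun y : ℝ => (digamma (1 / 4 + y / 2 * I)).re * P y := by
    have := hiD.re
    refine this.congr (Eventually.of_forall fun y => ?_)
    simp only [RCLike.re_to_complex]
    rw [← ofReal_mul, ofReal_re]
  have hE1 : (∫ y : ℝ, P y) = 4 * π * ∫ t, ‖g t‖ ^ 2 := by
    have h := integral_weilMellin_weilSymm_half hG
    simp only [hP] at h
    rw [hGdef, weilConv_weilReflect_apply_zero] at h
    exact_mod_cast h
  have hE2 : (∫ y : ℝ, (digamma (1 / 4 + y / 2 * I)).re * P y) = 2 * (weilArchIntegral G).re := by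
    have h := integral_reDigamma_mul_weilMellin_weilSymm hG
    simp only [hP] at h
    have h2 := integral_re hiD
    simp only [RCLike.re_to_complex] at h2
    rw [h] at h2
    have e : (fun y : ℝ => ((((digamma (1 / 4 + y / 2 * I)).re : ℝ) : ℂ) * (P y : ℂ)).re) =
        fun y : ℝ => (digamma (1 / 4 + y / 2 * I)).re * P y := by
      funext y; rw [← ofReal_mul, ofReal_re]
    rw [e] at h2
    rw [h2]
    simp
  have hE : (∫ y : ℝ, (1 / 2 - Real.log π / 2 + (digamma (1 / 4 + y / 2 * I)).re / 2) * P y) =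
      (1 / 2 - Real.log π / 2) * (4 * π * ∫ t, ‖g t‖ ^ 2) + (weilArchIntegral G).re := by
    have e : (fun y : ℝ => (1 / 2 - Real.log π / 2 + (digamma (1 / 4 + y / 2 * I)).re / 2) * P y) =
        fun y : ℝ => (1 / 2 - Real.log π / 2) * P y +
          (1 / 2) * ((digamma (1 / 4 + y / 2 * I)).re * P y) := by
      funext y; ring
    rw [e, integral_add (hiPr.const_mul _) (hiDr.const_mul _), integral_const_mul, integral_const_mul,
      hE1, hE2]
    ring
  rw [hE, weilMellin_weilSymm_one hG] at hlim
  -- bookkeeping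
  have hT0 : (∑' n : ℕ, ((c n : ℝ) : ℂ) / (Real.sqrt n : ℂ) * weilSymm G (Real.log n)) =
      ∑' n : ℕ, ((c n : ℝ) : ℂ) / (Real.sqrt n : ℂ) * (G (Real.log n) + G (-Real.log n)) := rfl
  rw [hT0] at hlim
  have hAT : (weilArchTerm G).re = 1 / (2 * π) * (weilArchIntegral G).re - (∫ t, ‖g t‖ ^ 2) * Real.log π := by
    rw [weilArchTerm, sub_re, hGdef, weilConv_weilReflect_apply_zero, ← ofReal_mul, ofReal_re]
    have e : (1 / (2 * π) : ℂ) = ((1 / (2 * π) : ℝ) : ℂ) := by push_cast; ring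
    rw [e, re_ofReal_mul]
  rw [sub_re, add_re, hAT]
  have hπ : 0 < 2 * π := by positivity
  have key : 2 * π * (∑' n : ℕ, ((c n : ℝ) : ℂ) / (Real.sqrt n : ℂ) * (G (Real.log n) + G (-Real.log n))).re ≤
      2 * π * ((weilPolarTerm G).re + (1 / (2 * π) * (weilArchIntegral G).re -
        (∫ t, ‖g t‖ ^ 2) * Real.log π) + ∫ t, ‖g t‖ ^ 2) := by
    refine hlim.trans (le_of_eq ?_)
    field_simp
    ring
  have := le_of_mul_le_mul_left key hπ
  linarith

/-- **Carathéodory ⟹ unit slack** (the converse of `stub_cara`, Poisson form of the majorant as in the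
skeleton of crux `ConeMagnification`): if `Σ|c(n)|n^{-σ} < ∞` for `σ > 1` and some `F` holomorphic on
`Re s > 1/2` equals `L_c − 1/(s−1)` on `Re s > 1` with
`Re F(s) ≤ 1/2 + Re(1/s) + (1/2π)∫ Re ψ(1/4+iv/2)·(σ−½)/((σ−½)²+(t−v)²) dv − ½ log π`, then for every Weil
test `g`, `−‖g‖₂² ≤ Re (W_ar(g ⋆ g̃) − Σₙ c(n) n^{-1/2} ((g⋆g̃)(log n) + (g⋆g̃)(−log n)))`.  No sign or
normalisation of `c` is needed.  With `stub_cara` (and `stub_fakePNT`, `stub_chebyshev`, `stub_continuation`,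
`stub_pdLaplace`): for `c ≥ 0`, `c 1 = 0`, unit slack ⟺ (`Σ c(n)n^{-σ} < ∞`, `σ > 1`) ∧ Carathéodory.
[folklore] -/
theorem unitSlack_of_cara :
    ∀ c : ℕ → ℝ, (∀ σ : ℝ, 1 < σ → LSeriesSummable (fun n => ((c n : ℝ) : ℂ)) σ) →
      (∃ F : ℂ → ℂ, DifferentiableOn ℂ F {s : ℂ | 1 / 2 < s.re} ∧
        (∀ s : ℂ, 1 < s.re → F s = LSeries (fun n => ((c n : ℝ) : ℂ)) s - 1 / (s - 1)) ∧
        ∀ s : ℂ, 1 / 2 < s.re →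
          (F s).re ≤ 1 / 2 + (1 / s).re +
            1 / (2 * Real.pi) * (∫ v : ℝ, (Complex.digamma (1 / 4 + v / 2 * Complex.I)).re *
              ((s.re - 1 / 2) / ((s.re - 1 / 2) ^ 2 + (s.im - v) ^ 2))) - Real.log Real.pi / 2) →
      ∀ g : ℝ → ℂ, IsWeilTest g →
        -(∫ t, ‖g t‖ ^ 2) ≤
          (weilPolarTerm (weilConv g (weilReflect g)) + weilArchTerm (weilConv g (weilReflect g)) -
            ∑' n : ℕ, ((c n : ℝ) : ℂ) / (Real.sqrt n : ℂ) *
              (weilConv g (weilReflect g) (Real.log n) + weilConv g (weilReflect g) (-Real.log n))).re := by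
  rintro c hsum ⟨F, hFd, hFL, hFA⟩ g hg
  refine unitSlack_of_cara_digamma hsum hFd hFL (fun s hs => ?_) hg
  have h := hFA s hs
  rw [poissonArch_eq_half_re_digamma hs] at h
  linarith

end Summit.RiemannHypothesis.RiemannHypothesis.Theorems.SignConeConeMagnification

end
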